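import Summits.Schanuel.Schanuel.Theorems.SoloInformedTheoremX193
import Summits.Schanuel.Schanuel.Theorems.SoloInformedX193PairLawsU

/-!
# X193 kernel, file F17 — THEOREM X193-K, UNCONDITIONAL (layer C assembly)

Solo-informed Schanuel programme (toy line X), kernel of Roy's small value programme
[Roy2010].  File F12 (`SoloInformedTheoremX193`) proved THEOREM X193-K — for `ξ ∈ ℂ`
transcendental, `β > 2`, `0 < σ < 1`, every exponent

  `ν > ν*(β, σ) := 1 + β − σβ/(β + σ)`

is an exponent of the additive small value estimate at the multiples `iξ` without
derivatives (`τ = 0`) — CONDITIONALLY on Roy's resultant estimate [Roy2010, Prop. 3.1], the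
named fact `Literature.NumberTheory.Transcendental.Roy2010.prop_3_1`, taken as a hypothesis.
Layer C removes that hypothesis: the only instance used (`t = 1`, a coprime pair) is proved
in the tree (F13 `SoloInformedX193EvalDet`, F14 `SoloInformedX193UnitCircle`, F15
`SoloInformedX193ResultantT1`: `soloX_res_coprime`), the laws (PAIR), (L1) are re-derived
from it (F16 `SoloInformedX193PairLawsU`), and this file repeats the assembly of F12 verbatim
with the `U`-laws:

  `soloX_theoremX193U : Transcendental ℚ ξ → 2 < β → 0 < σ → σ < 1 →
      Set.Ioi (1 + β - σ * β / (β + σ)) ⊆ royAdditiveSVEExponents ξ β σ 0`,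

and its restatement in Roy's wording `soloX_theoremX193U_heightData`.  Context (all in the
tree): the box principle forbids `ν < 1 + β − σ` (`royAdditiveSVEExponents_subset_Ici`), the
one-point Gel'fond argument gives `ν > 1 + β` (`Ioi_subset_royAdditiveSVEExponents`); Roy's
[Roy2010, Thm 1.1 (3)] (named fact `thm_1_1_part3`, not proved in the tree) gives
`ν > 1 + β − (3/4)σ`, which the present threshold beats iff `σ < β/3`
(`soloX_threshold_lt_roy_iff`), in particular for all `σ ≤ 2/3`.

No hypotheses beyond `ξ` transcendental and the parameter ranges; no sorries; no definitions.
-/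

namespace Summit.Schanuel.Schanuel.Theorems

open Polynomial Filter
open Literature.NumberTheory.Transcendental.Roy2010

/-! ### No Roy data in the window -/

/-- **The contradiction**, unconditionally.  For `ξ` transcendental, `β > 2`, `0 < σ < 1` and
`ν* < ν < 1 + β`, there is no sequence `R n ∈ RoyAdditiveSmall ξ β σ 0 ν n` (`n ≥ n₀`): its
pieces would satisfy the seven laws, which `SoloServiceData.false_of_laws` refutes at
`γ = ν − 1 − β + σ`. -/
theorem soloX_no_roy_dataU {ξ : ℂ} (hξ : Transcendental ℚ ξ) {β σ ν : ℝ}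
    (hβ : 2 < β) (hσ0 : 0 < σ) (hσ1 : σ < 1) (hν : 1 + β - σ * β / (β + σ) < ν)
    (hν' : ν < 1 + β) {R : ℕ → ℤ[X]} {n₀ : ℕ}
    (hR : ∀ n, n₀ ≤ n → R n ∈ RoyAdditiveSmall ξ β σ 0 ν n) : False := by
  have hξ0 : ξ ≠ 0 := soloX_ne_zero_of_transcendental hξ
  obtain ⟨hγσ, hthr, hνγ⟩ := soloX_window_exponent (by linarith : 0 < β + σ) hν hν'
  exact (soloX_pieces ξ R).false_of_laws (soloX_pieces_wellFormed hξ0 R) (soloX_c₀_nonneg ξ)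
    (soloX_pieces_budgetLaw hR) (soloX_pieces_serviceLaw hξ hR) (soloX_pieces_pairLawU hξ R)
    (soloX_pieces_entryLawU hξ hσ0 hσ1.le hR) (soloX_pieces_twistLaw hξ R)
    (soloX_pieces_finiteLaw hξ0 R) hβ hσ0 hσ1.le hγσ hthr hνγ (by norm_num)
    (soloX_pairConst_nonneg ξ) (soloX_pairConst_nonneg ξ)

/-- **The window**, unconditionally.  Every `ν ∈ (ν*, 1 + β)` is an exponent of the
additive small value estimate at `ξ` (`τ = 0`). -/
theorem soloX_Ioo_subset_royAdditiveSVEExponentsU {ξ : ℂ} (hξ : Transcendental ℚ ξ)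
    {β σ : ℝ} (hβ : 2 < β) (hσ0 : 0 < σ) (hσ1 : σ < 1) :
    Set.Ioo (1 + β - σ * β / (β + σ)) (1 + β) ⊆ royAdditiveSVEExponents ξ β σ 0 := by
  intro ν hν
  by_contra hcon
  have hev : ∀ᶠ n : ℕ in atTop, (RoyAdditiveSmall ξ β σ 0 ν n).Nonempty :=
    (Filter.not_frequently.mp hcon).mono fun n hn => not_not.mp hn
  obtain ⟨n₀, hn₀⟩ := Filter.eventually_atTop.mp hev
  have hex : ∀ n : ℕ, ∃ P : ℤ[X], n₀ ≤ n → P ∈ RoyAdditiveSmall ξ β σ 0 ν n := fun n => by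
    by_cases h : n₀ ≤ n
    · exact ⟨(hn₀ n h).some, fun _ => (hn₀ n h).some_mem⟩
    · exact ⟨0, fun h' => absurd h' h⟩
  choose R hR using hex
  exact soloX_no_roy_dataU hξ hβ hσ0 hσ1 hν.1 hν.2 hR

/-- **THEOREM X193-K, UNCONDITIONAL.**  For `ξ ∈ ℂ` transcendental, `β > 2` and
`0 < σ < 1`: every `ν > 1 + β − σβ/(β + σ)` is an exponent of the additive small value estimate
at the multiples of `ξ` without derivatives —
`Set.Ioi (1 + β − σβ/(β+σ)) ⊆ royAdditiveSVEExponents ξ β σ 0`.  (The statement of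
`soloX_theoremX193` with the hypothesis `prop_3_1` removed.) -/
theorem soloX_theoremX193U {ξ : ℂ} (hξ : Transcendental ℚ ξ) {β σ : ℝ}
    (hβ : 2 < β) (hσ0 : 0 < σ) (hσ1 : σ < 1) :
    Set.Ioi (1 + β - σ * β / (β + σ)) ⊆ royAdditiveSVEExponents ξ β σ 0 := by
  intro ν hν
  rw [Set.mem_Ioi] at hν
  have hlt : 1 + β - σ * β / (β + σ) < 1 + β := soloX_threshold_lt (by linarith) hσ0
  by_cases h : ν < 1 + β
  · exact soloX_Ioo_subset_royAdditiveSVEExponentsU hξ hβ hσ0 hσ1 ⟨hν, h⟩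
  · have hmid : (1 + β - σ * β / (β + σ) + (1 + β)) / 2 ∈
        Set.Ioo (1 + β - σ * β / (β + σ)) (1 + β) := ⟨by linarith, by linarith⟩
    have hmem := soloX_Ioo_subset_royAdditiveSVEExponentsU hξ hβ hσ0 hσ1 hmid
    exact isUpperSet_royAdditiveSVEExponents ξ β σ 0 (by linarith) hmem

/-! ### Roy's wording -/

/-- **X193-K in Roy's wording, unconditional** (`τ = 0`, cf. `thm_1_1_part3`): for `ξ`
transcendental, `β > 2`, `0 < σ < 1`, `ν > 1 + β − σβ/(β + σ)` and every sequence of non-zero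
`P n ∈ ℤ[T]` (`n ≥ n₀`) with `deg P n ≤ n`, `‖P n‖_∞ ≤ exp(n^β)`: for infinitely many `n`,
`max {|P_n^{[j]}(iξ)| ; i ≤ n^σ, j ≤ n^0} > exp(−n^ν)`. -/
theorem soloX_theoremX193U_heightData {ξ : ℂ} (hξ : Transcendental ℚ ξ) {β σ ν : ℝ}
    (hβ : 2 < β) (hσ0 : 0 < σ) (hσ1 : σ < 1)
    (hν : 1 + β - σ * β / (β + σ) < ν) (P : ℕ → ℤ[X]) (n₀ : ℕ) (hP : HeightData β P n₀) :
    ∃ᶠ n : ℕ in atTop, ∃ i j : ℕ, (i : ℝ) ≤ (n : ℝ) ^ σ ∧ (j : ℝ) ≤ (n : ℝ) ^ (0 : ℝ) ∧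
      Real.exp (-(n : ℝ) ^ ν) < ‖aeval ((i : ℂ) * ξ) (hasseDeriv j (P n))‖ := by
  have hmem : ν ∈ royAdditiveSVEExponents ξ β σ 0 := soloX_theoremX193U hξ hβ hσ0 hσ1 hν
  have hfr : ∃ᶠ n : ℕ in atTop, ¬ (RoyAdditiveSmall ξ β σ 0 ν n).Nonempty := hmem
  refine (hfr.and_eventually (eventually_ge_atTop n₀)).mono ?_
  rintro n ⟨hno, hn⟩
  obtain ⟨hP0, hdeg, hht⟩ := hP n hn
  by_contra hcon
  simp only [not_exists, not_and, not_lt] at hcon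
  exact hno ⟨P n, hP0, hdeg, (soloX_polyHeight_le_supNorm _).trans hht,
    fun i j hi hj => hcon i j hi hj⟩

end Summit.Schanuel.Schanuel.Theorems
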